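import Literature.MathematicalPhysics.QuantumFieldTheory.Balaban1983to89.B15Prop1DatumGaugeNormalisation
import Literature.MathematicalPhysics.QuantumFieldTheory.Balaban1983to89.B12RegularClassInvariance263
import Literature.MathematicalPhysics.QuantumFieldTheory.Balaban1983to89.T4ExpWindowSmallField
import HarnessLib

/-!
# THE GAUGE-CONJUGATE PROBE: a one-bond right exponential move at `U` read at the gauge copy `U^u` (LEAD-20520 w3 g24 WORD №7 (C) «CONJ-PROBE»), DEFINITION-FREE

Cell `ym3-torus` (YM ladder rung R3 = continuum `SU(2)` Yang–Mills on the three-torus — a RUNG, NOT d = 4, NOT infinite volume, NOT a mass gap,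
NOT Clay).  Seat `ym-line-cst-p1` g40 (FREE prover hand; base items stmt-QuantumFields-25301∕25302 untouched); `--supports stmt-QuantumFields-20520
--as helper`, count-neutral, definition-free, default heartbeats; no registry, binder or `Lines/` edit; the registered skeleton
`Lines/semiclassical_s2beta.lean` v11.4 and its five stubs are untouched (0∕5, ★★OWNER RULING №36).  v18-TEXT-INDEPENDENT.

WHY.  w4 g22's (P-b′) small-step chord path (`…OrganTangentSmallStepChordPath.exists_smallStep_chordPath_gaugeCopy`) ends at the SMALL-GAUGE COPY
`U^u = GaugeField.gaugeAct u U` of the target `U`, while the organ's pair clause ∕ S3's one-bond text probe AT `U`: `R (update U b (U b · expPt v)) − R U`.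
By ✓p794698 (`…OrganTangentWindowGaugeInvariance.gaugeInvariant_organDiscrepancy`) the remainder `R` is GAUGE INVARIANT, so a probe at `U` reads as a probe
at `U^u` with the excitation CONJUGATED at the bond's endpoint: `(U[b ↦ U_b·g])^u = U^u[b ↦ U^u_b · (u(b₊)·g·u(b₊)⁻¹)]` and, for `G = SU(2)`,
`u(b₊)·expPt v·u(b₊)⁻¹ = expPt v′` with `v′ := Ad_{u(b₊)} v` (lit ✓`B15Prop1ChartSU2.iexp_adSU2`), `‖toE v′‖ = ‖toE v‖` (lit ✓`norm_adSU2_eq`), hence the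
sup-norm size `‖v′‖ ≤ ‖toE v′‖ = ‖toE v‖ ≤ √3·‖v‖` and `dist1 (expPt v′) = dist1 (expPt v)` — the telescope (crux-dir `GROrganTelescope.firstDiff_window_path`,
✓`…OrganTangentTelescopeWindowPath`) runs to `U^u` and the anchor∕probe letters are unchanged up to `√3` (LEAD WORD №7 (A)).

WHAT (all kernel-checked, no `sorry`; §1 for ANY gauge group, §2–§3 at `SU(2)` = `Matrix.specialUnitaryGroup (Fin 2) ℂ` with the lit chart `T4CubeChartExp.expPt`).
§1 ★`gaugeAct_update_mul` — `(U[b ↦ U_b·g])^u = U^u[b ↦ U^u_b·(u(b₊) g u(b₊)⁻¹)]`; `update_gaugeAct_mul` (the converse reading); `apply_update_mul_of_gaugeInvariant`,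
   `sub_update_mul_of_gaugeInvariant` (a gauge-invariant functional and its one-bond first difference read at `U^u`); `plaqSmall_update_mul_gaugeAct_iff` (windows).
§2 `conj_expPt` — `g·expPt v·g⁻¹ = expPt (Ad_g v)` (`Ad_g v := WithLp.ofLp (adSU2 g (toE v))`); `norm_ofLp_le` (`‖·‖_sup ≤ ‖·‖₂` on `ℝ³`), `norm_toE_le`
   (`‖toE v‖ ≤ √3‖v‖`), `norm_toE_adVec` (`= ‖toE v‖`), ★`norm_adVec_le` (`≤ √3‖v‖`), `dist1_expPt_adVec` (`dist1` unchanged), `adVec_zero`.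
§3 ★★`gaugeAct_update_mul_expPt` ∕ `update_gaugeAct_mul_expPt` (both directions, explicit vectors), ★★`firstDiff_probe_eq_of_gaugeInvariant`,
   `secondDiff_probe_eq_of_gaugeInvariant` (the pair-clause four corners), `plaqSmall_probe_gaugeAct_iff`, and the packaged ∃-forms
   ★★★`exists_conjugateProbe` (probe at `U` ⇒ probe at `U^u`, `‖v′‖ ≤ √3‖v‖`, `‖toE v′‖ = ‖toE v‖`, `dist1 (expPt v′) = dist1 (expPt v)`, windows and first
   difference transported) and ★★★`exists_conjugateProbe_symm` (probe at `U^u` ⇒ probe at `U`, same letters).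

HONEST FRAMING: lattice∕Lie-group bookkeeping (`SU(2)` adjoint action is an isometry; gauge action vs `Function.update`); nothing of Bałaban's
renormalisation-group analysis is asserted; TN-GR (v), O1∕O1ᵘ-H, S3ᴴ, the crux `FluctuationComparisonRegPrIntL` (stmt-QuantumFields-20520) and `YM3TorusSU2`
are NOT proved; no summit ∕ sub-problem statement is proved; rung R3 = SU(2) YM₃ on T³ — NOT d = 4, NOT infinite volume, NOT a mass gap, NOT Clay; the
Yang–Mills mass gap is NOT proved by any of this.
[cite: Balaban1985Averaging, (8)-(9) p.19; Balaban1989LargeFieldI, (1.77) p.194; Balaban1987RG1, (0.13) p.254]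
-/

set_option autoImplicit false

noncomputable section

namespace Summit.QuantumFields.YangMills.Theorems.OrganTangentGaugeConjugateProbe

open Function
open Literature.MathematicalPhysics.QuantumFieldTheory
open Literature.MathematicalPhysics.QuantumFieldTheory.Balaban1983to89
open T4CubeChartGnomonic (SU2)
open T4HaarSU2ExpChart (expPoint)
open T4CubeChartExp (toE expPt expPt_zero)
open T4CubePoincare (cube mem_cube_iff)
open T4ExpWindowSmallField (dist1_expPt_le norm_toE_le_of_mem_cube)
open B15Prop1ChartSU2 (adSU2 iexp_adSU2 su2Chart_iexp)
open B15Prop1DatumGaugeNormalisation (norm_adSU2_eq)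
open B15Prop1ChartCalculusSU2 (adSU2_inv_adSU2 adSU2_adSU2_inv)
open B12RegularClassInvariance263 (plaqSmall_gaugeAct_iff)

/-! ## §1 Any gauge group: `update` after a gauge transformation -/

section AnyGroup

variable {P : Params} {j : ℕ} {G : Type*} [GaugeGroup G] [DecidableEq (PBond P j)]

/-- ★ **RIGHT MULTIPLICATIVE UPDATE UNDER A GAUGE TRANSFORMATION**: `(U[b ↦ U_b·g])^u = U^u[b ↦ U^u_b·(u(b₊)·g·u(b₊)⁻¹)]` — the excitation is
conjugated by the gauge value at the bond's END point (`U^u(b) = u(b₋) U(b) u(b₊)⁻¹`). [cite: Balaban1985Averaging, (8) p.19] -/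
theorem gaugeAct_update_mul (u : GaugeTransf P j G) (U : GaugeField P j G) (b : PBond P j) (g : G) :
    GaugeField.gaugeAct u (update U b (U b * g)) =
      update (GaugeField.gaugeAct u U) b (GaugeField.gaugeAct u U b * (u b.tgt * g * (u b.tgt)⁻¹)) := by
  funext e
  by_cases h : e = b
  · subst h
    simp only [GaugeField.gaugeAct, update_self]
    group
  · simp only [GaugeField.gaugeAct, update_of_ne h]

/-- The converse reading: `U^u[b ↦ U^u_b·g] = (U[b ↦ U_b·(u(b₊)⁻¹·g·u(b₊))])^u`. [cite: Balaban1985Averaging, (8) p.19] -/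
theorem update_gaugeAct_mul (u : GaugeTransf P j G) (U : GaugeField P j G) (b : PBond P j) (g : G) :
    update (GaugeField.gaugeAct u U) b (GaugeField.gaugeAct u U b * g) =
      GaugeField.gaugeAct u (update U b (U b * ((u b.tgt)⁻¹ * g * u b.tgt))) := by
  rw [gaugeAct_update_mul]
  congr 2
  group

/-- A GAUGE-INVARIANT functional reads the right-updated configuration at the gauge copy with the conjugated excitation.
[cite: Balaban1985Averaging, (12) p.19] -/
theorem apply_update_mul_of_gaugeInvariant {α : Type*} (R : GaugeField P j G → α) (hR : GaugeField.GaugeInvariant R)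
    (u : GaugeTransf P j G) (U : GaugeField P j G) (b : PBond P j) (g : G) :
    R (update U b (U b * g)) = R (update (GaugeField.gaugeAct u U) b (GaugeField.gaugeAct u U b * (u b.tgt * g * (u b.tgt)⁻¹))) := by
  rw [← gaugeAct_update_mul, hR]

/-- The one-bond FIRST DIFFERENCE of a gauge-invariant functional at `U` equals the first difference at `U^u` with the conjugated excitation.
[cite: Balaban1985Averaging, (12) p.19] -/
theorem sub_update_mul_of_gaugeInvariant {α : Type*} [Sub α] (R : GaugeField P j G → α) (hR : GaugeField.GaugeInvariant R)
    (u : GaugeTransf P j G) (U : GaugeField P j G) (b : PBond P j) (g : G) :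
    R (update U b (U b * g)) - R U =
      R (update (GaugeField.gaugeAct u U) b (GaugeField.gaugeAct u U b * (u b.tgt * g * (u b.tgt)⁻¹))) - R (GaugeField.gaugeAct u U) := by
  rw [apply_update_mul_of_gaugeInvariant R hR u U b g, hR u U]

/-- Windows transport: the right-updated configuration is `θ`-small iff its gauge reading is. [cite: Balaban1987RG1, (0.13) p.254] -/
theorem plaqSmall_update_mul_gaugeAct_iff (θ : ℝ) (u : GaugeTransf P j G) (U : GaugeField P j G) (b : PBond P j) (g : G) :
    PlaqSmall θ (update (GaugeField.gaugeAct u U) b (GaugeField.gaugeAct u U b * (u b.tgt * g * (u b.tgt)⁻¹))) ↔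
      PlaqSmall θ (update U b (U b * g)) := by
  rw [← gaugeAct_update_mul, plaqSmall_gaugeAct_iff]

end AnyGroup

/-! ## §2 `SU(2)`: conjugating the exponential chart point = rotating its coordinate vector -/

section LieAlgebra

/-- `‖x‖_sup ≤ ‖x‖₂` for the coordinates of a Euclidean vector of `ℝ³` (each coordinate is bounded by the Euclidean norm). [folklore] -/
theorem norm_ofLp_le (x : EuclideanSpace ℝ (Fin 3)) : ‖WithLp.ofLp x‖ ≤ ‖x‖ :=
  (pi_norm_le_iff_of_nonneg (norm_nonneg x)).2 fun i => PiLp.norm_apply_le x i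

/-- `‖toE v‖₂ ≤ √3·‖v‖_sup` (lit ✓`norm_toE_le_of_mem_cube` on the cube of side `‖v‖`). [folklore] -/
theorem norm_toE_le (v : Fin 3 → ℝ) : ‖toE v‖ ≤ Real.sqrt 3 * ‖v‖ :=
  norm_toE_le_of_mem_cube (mem_cube_iff.2 fun i => by rw [← Real.norm_eq_abs]; exact norm_le_pi_norm v i)

/-- `toE (WithLp.ofLp x) = x`. [folklore] -/
theorem toE_ofLp (x : EuclideanSpace ℝ (Fin 3)) : toE (WithLp.ofLp x) = x := rfl

/-- **CONJUGATION = ADJOINT ROTATION OF THE COORDINATES**: `g·expPt v·g⁻¹ = expPt (Ad_g v)` with `Ad_g v := WithLp.ofLp (adSU2 g (toE v))`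
(lit ✓`B15Prop1ChartSU2.iexp_adSU2`). [cite: Balaban1989LargeFieldI, (1.77) p.194] -/
theorem conj_expPt (g : SU2) (v : Fin 3 → ℝ) : g * expPt v * g⁻¹ = expPt (WithLp.ofLp (adSU2 g (toE v))) := by
  have h := iexp_adSU2 g (toE v)
  simp only [su2Chart_iexp] at h
  rw [expPt, expPt, toE_ofLp, h]

/-- `‖toE (Ad_g v)‖ = ‖toE v‖` — the adjoint action is a Euclidean isometry (lit ✓`norm_adSU2_eq`). [cite: Balaban1989LargeFieldI, (1.77) p.194] -/
theorem norm_toE_adVec (g : SU2) (v : Fin 3 → ℝ) : ‖toE (WithLp.ofLp (adSU2 g (toE v)))‖ = ‖toE v‖ := by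
  rw [toE_ofLp, norm_adSU2_eq]

/-- ★ **THE SUP-NORM SIZE OF THE ROTATED VECTOR**: `‖Ad_g v‖_sup ≤ √3·‖v‖_sup` (`‖·‖_sup ≤ ‖·‖₂ = ‖toE v‖₂ ≤ √3‖v‖_sup`). [folklore] -/
theorem norm_adVec_le (g : SU2) (v : Fin 3 → ℝ) : ‖WithLp.ofLp (adSU2 g (toE v))‖ ≤ Real.sqrt 3 * ‖v‖ :=
  (norm_ofLp_le _).trans ((norm_adSU2_eq g (toE v)).le.trans (norm_toE_le v))

/-- `dist1 (expPt (Ad_g v)) = dist1 (expPt v)` (a conjugate has the same distance to `1`). [folklore] -/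
theorem dist1_expPt_adVec (g : SU2) (v : Fin 3 → ℝ) : dist1 (expPt (WithLp.ofLp (adSU2 g (toE v)))) = dist1 (expPt v) := by
  rw [← conj_expPt, GaugeGroup.dist1_conj]

/-- `Ad_g 0 = 0`. [folklore] -/
theorem adVec_zero (g : SU2) : WithLp.ofLp (adSU2 g (toE 0)) = 0 := by
  rw [show toE 0 = 0 from rfl, map_zero]; rfl

/-- Rotating back: `Ad_{g⁻¹} (Ad_g v) = v` (lit ✓`B15Prop1ChartCalculusSU2.adSU2_inv_adSU2`). [folklore] -/
theorem adVec_inv_adVec (g : SU2) (v : Fin 3 → ℝ) : WithLp.ofLp (adSU2 g⁻¹ (toE (WithLp.ofLp (adSU2 g (toE v))))) = v := by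
  rw [toE_ofLp, adSU2_inv_adSU2]

/-- Rotating forth: `Ad_g (Ad_{g⁻¹} w) = w` (lit ✓`B15Prop1ChartCalculusSU2.adSU2_adSU2_inv`). [folklore] -/
theorem adVec_adVec_inv (g : SU2) (w : Fin 3 → ℝ) : WithLp.ofLp (adSU2 g (toE (WithLp.ofLp (adSU2 g⁻¹ (toE w))))) = w := by
  rw [toE_ofLp, adSU2_adSU2_inv]

end LieAlgebra

/-! ## §3 `SU(2)` gauge fields: the conjugate probe -/

section Probe

variable {P : Params} {j : ℕ} [DecidableEq (PBond P j)]

/-- ★★ **THE CONJUGATE PROBE (forward)**: `(U[b ↦ U_b·expPt v])^u = U^u[b ↦ U^u_b·expPt (Ad_{u(b₊)} v)]`. [cite: Balaban1985Averaging, (8) p.19; Balaban1989LargeFieldI, (1.77) p.194] -/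
theorem gaugeAct_update_mul_expPt (u : GaugeTransf P j SU2) (U : GaugeField P j SU2) (b : PBond P j) (v : Fin 3 → ℝ) :
    GaugeField.gaugeAct u (update U b (U b * expPt v)) =
      update (GaugeField.gaugeAct u U) b (GaugeField.gaugeAct u U b * expPt (WithLp.ofLp (adSU2 (u b.tgt) (toE v)))) := by
  rw [gaugeAct_update_mul, conj_expPt]

/-- ★★ **THE CONJUGATE PROBE (backward)**: `U^u[b ↦ U^u_b·expPt w] = (U[b ↦ U_b·expPt (Ad_{u(b₊)⁻¹} w)])^u`. [cite: Balaban1985Averaging, (8) p.19; Balaban1989LargeFieldI, (1.77) p.194] -/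
theorem update_gaugeAct_mul_expPt (u : GaugeTransf P j SU2) (U : GaugeField P j SU2) (b : PBond P j) (w : Fin 3 → ℝ) :
    update (GaugeField.gaugeAct u U) b (GaugeField.gaugeAct u U b * expPt w) =
      GaugeField.gaugeAct u (update U b (U b * expPt (WithLp.ofLp (adSU2 (u b.tgt)⁻¹ (toE w))))) := by
  rw [update_gaugeAct_mul, ← conj_expPt, inv_inv]

/-- Windows: the probe-moved configuration at `U` is `θ`-small iff the conjugate-probe-moved gauge copy is. [cite: Balaban1987RG1, (0.13) p.254] -/
theorem plaqSmall_probe_gaugeAct_iff (θ : ℝ) (u : GaugeTransf P j SU2) (U : GaugeField P j SU2) (b : PBond P j) (v : Fin 3 → ℝ) :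
    PlaqSmall θ (update (GaugeField.gaugeAct u U) b (GaugeField.gaugeAct u U b * expPt (WithLp.ofLp (adSU2 (u b.tgt) (toE v))))) ↔
      PlaqSmall θ (update U b (U b * expPt v)) := by
  rw [← gaugeAct_update_mul_expPt, plaqSmall_gaugeAct_iff]

/-- A gauge-invariant functional at the probe-moved `U` = the functional at the conjugate-probe-moved `U^u`. [cite: Balaban1985Averaging, (12) p.19] -/
theorem probe_eq_of_gaugeInvariant {α : Type*} (R : GaugeField P j SU2 → α) (hR : GaugeField.GaugeInvariant R)
    (u : GaugeTransf P j SU2) (U : GaugeField P j SU2) (b : PBond P j) (v : Fin 3 → ℝ) :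
    R (update U b (U b * expPt v)) =
      R (update (GaugeField.gaugeAct u U) b (GaugeField.gaugeAct u U b * expPt (WithLp.ofLp (adSU2 (u b.tgt) (toE v))))) := by
  rw [← gaugeAct_update_mul_expPt, hR]

/-- ★★ **FIRST DIFFERENCES TRANSPORT**: for a gauge-invariant `R`,
`R (U[b ↦ U_b·expPt v]) − R U = R (U^u[b ↦ U^u_b·expPt v′]) − R (U^u)`, `v′ = Ad_{u(b₊)} v`. [cite: Balaban1985Averaging, (12) p.19] -/
theorem firstDiff_probe_eq_of_gaugeInvariant {α : Type*} [Sub α] (R : GaugeField P j SU2 → α) (hR : GaugeField.GaugeInvariant R)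
    (u : GaugeTransf P j SU2) (U : GaugeField P j SU2) (b : PBond P j) (v : Fin 3 → ℝ) :
    R (update U b (U b * expPt v)) - R U =
      R (update (GaugeField.gaugeAct u U) b (GaugeField.gaugeAct u U b * expPt (WithLp.ofLp (adSU2 (u b.tgt) (toE v))))) -
        R (GaugeField.gaugeAct u U) := by
  rw [probe_eq_of_gaugeInvariant R hR u U b v, hR u U]

/-- **SECOND DIFFERENCES TRANSPORT** (the pair clause's four corners `U`, `U[b ↦ ·]`, `U[b′ ↦ ·]`, `U[b ↦ ·][b′ ↦ ·]`): every corner is read at the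
gauge copy with the excitations rotated by `Ad_{u(b₊)}` resp. `Ad_{u(b′₊)}`. [cite: Balaban1985Averaging, (12) p.19] -/
theorem secondDiff_probe_eq_of_gaugeInvariant (R : GaugeField P j SU2 → ℝ) (hR : GaugeField.GaugeInvariant R)
    (u : GaugeTransf P j SU2) (U : GaugeField P j SU2) (b b' : PBond P j) (v v' : Fin 3 → ℝ) :
    R (update (update U b (U b * expPt v)) b' (update U b (U b * expPt v) b' * expPt v'))
        - R (update U b (U b * expPt v)) - R (update U b' (U b' * expPt v')) + R U =
      R (update (update (GaugeField.gaugeAct u U) b (GaugeField.gaugeAct u U b * expPt (WithLp.ofLp (adSU2 (u b.tgt) (toE v))))) b'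
            (update (GaugeField.gaugeAct u U) b (GaugeField.gaugeAct u U b * expPt (WithLp.ofLp (adSU2 (u b.tgt) (toE v)))) b' *
              expPt (WithLp.ofLp (adSU2 (u b'.tgt) (toE v')))))
        - R (update (GaugeField.gaugeAct u U) b (GaugeField.gaugeAct u U b * expPt (WithLp.ofLp (adSU2 (u b.tgt) (toE v)))))
        - R (update (GaugeField.gaugeAct u U) b' (GaugeField.gaugeAct u U b' * expPt (WithLp.ofLp (adSU2 (u b'.tgt) (toE v')))))
        + R (GaugeField.gaugeAct u U) := by
  rw [probe_eq_of_gaugeInvariant R hR u (update U b (U b * expPt v)) b' v', gaugeAct_update_mul_expPt,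
    probe_eq_of_gaugeInvariant R hR u U b v, probe_eq_of_gaugeInvariant R hR u U b' v', hR u U]

/-- ★★★ **THE CONJUGATE PROBE, PACKAGED (probe at `U` ⇒ probe at `U^u`)**: for a gauge-invariant `R`, every `u`, `U`, bond `b` and vector `v` there is
`v′` (`= Ad_{u(b₊)} v`) with `‖v′‖ ≤ √3·‖v‖`, `‖toE v′‖ = ‖toE v‖`, `dist1 (expPt v′) = dist1 (expPt v)`, `(U[b ↦ U_b·expPt v])^u = U^u[b ↦ U^u_b·expPt v′]`,
the same `θ`-windows, and `R (U[b ↦ U_b·expPt v]) − R U = R (U^u[b ↦ U^u_b·expPt v′]) − R (U^u)` — the glue between w4's (P-b′) endpoint `U^u` and the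
junction's probe at `U`. [cite: Balaban1985Averaging, (8)-(12) p.19; Balaban1989LargeFieldI, (1.77) p.194] -/
theorem exists_conjugateProbe (R : GaugeField P j SU2 → ℝ) (hR : GaugeField.GaugeInvariant R)
    (u : GaugeTransf P j SU2) (U : GaugeField P j SU2) (b : PBond P j) (v : Fin 3 → ℝ) :
    ∃ v' : Fin 3 → ℝ, ‖v'‖ ≤ Real.sqrt 3 * ‖v‖ ∧ ‖toE v'‖ = ‖toE v‖ ∧ dist1 (expPt v') = dist1 (expPt v) ∧
      GaugeField.gaugeAct u (update U b (U b * expPt v)) =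
        update (GaugeField.gaugeAct u U) b (GaugeField.gaugeAct u U b * expPt v') ∧
      (∀ θ : ℝ, PlaqSmall θ (update (GaugeField.gaugeAct u U) b (GaugeField.gaugeAct u U b * expPt v')) ↔
        PlaqSmall θ (update U b (U b * expPt v))) ∧
      R (update U b (U b * expPt v)) - R U =
        R (update (GaugeField.gaugeAct u U) b (GaugeField.gaugeAct u U b * expPt v')) - R (GaugeField.gaugeAct u U) :=
  ⟨WithLp.ofLp (adSU2 (u b.tgt) (toE v)), norm_adVec_le _ v, norm_toE_adVec _ v, dist1_expPt_adVec _ v,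
    gaugeAct_update_mul_expPt u U b v, fun θ => plaqSmall_probe_gaugeAct_iff θ u U b v,
    firstDiff_probe_eq_of_gaugeInvariant R hR u U b v⟩

/-- ★★★ **THE CONJUGATE PROBE, PACKAGED (probe at `U^u` ⇒ probe at `U`)**: for a gauge-invariant `R`, every `u`, `U`, `b`, `w` there is `w′`
(`= Ad_{u(b₊)⁻¹} w`) with `‖w′‖ ≤ √3·‖w‖`, `‖toE w′‖ = ‖toE w‖`, `dist1 (expPt w′) = dist1 (expPt w)`, `U^u[b ↦ U^u_b·expPt w] = (U[b ↦ U_b·expPt w′])^u`,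
the same `θ`-windows, and `R (U^u[b ↦ U^u_b·expPt w]) − R (U^u) = R (U[b ↦ U_b·expPt w′]) − R U`. [cite: Balaban1985Averaging, (8)-(12) p.19; Balaban1989LargeFieldI, (1.77) p.194] -/
theorem exists_conjugateProbe_symm (R : GaugeField P j SU2 → ℝ) (hR : GaugeField.GaugeInvariant R)
    (u : GaugeTransf P j SU2) (U : GaugeField P j SU2) (b : PBond P j) (w : Fin 3 → ℝ) :
    ∃ w' : Fin 3 → ℝ, ‖w'‖ ≤ Real.sqrt 3 * ‖w‖ ∧ ‖toE w'‖ = ‖toE w‖ ∧ dist1 (expPt w') = dist1 (expPt w) ∧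
      update (GaugeField.gaugeAct u U) b (GaugeField.gaugeAct u U b * expPt w) =
        GaugeField.gaugeAct u (update U b (U b * expPt w')) ∧
      (∀ θ : ℝ, PlaqSmall θ (update U b (U b * expPt w')) ↔
        PlaqSmall θ (update (GaugeField.gaugeAct u U) b (GaugeField.gaugeAct u U b * expPt w))) ∧
      R (update (GaugeField.gaugeAct u U) b (GaugeField.gaugeAct u U b * expPt w)) - R (GaugeField.gaugeAct u U) =
        R (update U b (U b * expPt w')) - R U := by
  refine ⟨WithLp.ofLp (adSU2 (u b.tgt)⁻¹ (toE w)), norm_adVec_le _ w, norm_toE_adVec _ w, dist1_expPt_adVec _ w,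
    update_gaugeAct_mul_expPt u U b w, fun θ => ?_, ?_⟩
  · rw [update_gaugeAct_mul_expPt, plaqSmall_gaugeAct_iff]
  · rw [update_gaugeAct_mul_expPt, hR, hR]

end Probe

end Summit.QuantumFields.YangMills.Theorems.OrganTangentGaugeConjugateProbe

end
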